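import Literature.Geometry.ComplexAnalytic.PhamBrieskornJoinHomology
import HarnessLib

/-!
# Symmetries of the affine Pham–Brieskorn fibre: the rotations of the last coordinate have no invariants
# on `Hₙ(F)`, and the sign change of two quadratic coordinates acts trivially (Milnor 1968 §9; the local
# model `z₀² + z₁² + z₂^p = 1` of the `A_{p−1}` point of a cyclic cover, Carlson–Toledo 1999 §6)

Family `hodge`, layer `Literature/Geometry/ComplexAnalytic`, sequel of `PhamBrieskornJoin`
(`F = fibre a = {Σ zᵢ^{aᵢ} = 1}`, the join `J ⊆ F` onto which `F` deformation retracts — Milnor Lemma 9.2,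
`joinHomotopyEquivFibre`) and `PhamBrieskornJoinHomology` (`eq_zero_of_forall_map_rotate_eq`: the rotations
of the last factor have no non-zero invariant vector on `Hₙ(J)`). Written by the prover seat
`hodge-nonav-prover-Ax` (g8, cell `hodge-nonav`) as the first brick of programme I2 — the discharge of the
cited LOCAL Picard–Lefschetz fact `carlsonToledo1999_nodalMeridianMonodromy_isCyclicReflection` (crux K1 of
route `Summits/HodgeConjecture/HodgeConjecture/Theses/CyclicUnitaryPowers.lean`): Carlson–Toledo §6, for the
degeneration (kdoublept) `y^k = x₁² + x₂²` of a `k`-fold cyclic cover, read the local monodromy `T` and the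
covering automorphism `σ` on the Milnor fibre `F = {x₁² + x₂² + y^k = 1}`: "`T = σ_0 ⊗ (−1) ⊗ (−1)`" (the
monodromy homeomorphism of the weighted-homogeneous family `x₁² + x₂² + y^k = t` is
`(x₁, x₂, y) ↦ (−x₁, −x₂, ζ_k y)`), and on `H₂(F)` "the local monodromy transformation is" the covering
rotation, with "eigenvalues the `k`-th roots of unity `μ ≠ 1`". This file PROVES, on the tree's carriers
(singular homology of the subspace `fibre a ⊆ ℂ^{n+1}`, any coefficient field of characteristic zero):

* §1 `PhamBrieskorn.rotateFibre` — the rotation `z ↦ (z₀, …, z_{n−1}, v zₙ)` of the LAST coordinate by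
  `v ∈ Ω_{aₙ}` as a self-homeomorphism of the fibre `F` (restricting to Milnor's `r_{aₙ}` on `J`), and
  **`eq_zero_of_forall_map_rotateFibre_eq` — a class of `Hₙ₊₁(F)` (`n + 2 ≥ 2` factors) fixed by all these
  rotations is zero** ("the eigenvalues of `r_{a*}` are the `a`-th roots of unity other than `1`"): transport
  of the join statement along the inclusion `J ↪ F`, a homotopy equivalence commuting with the rotations.
* §2 `PhamBrieskorn.negPairFibre` — the sign change `(zᵢ, zⱼ) ↦ (−zᵢ, −zⱼ)` of two QUADRATIC coordinates
  (`aᵢ = aⱼ = 2`, `i ≠ j`), and **`map_negPairFibre_eq_id` — it acts as the identity on `H_*(F)`**: it is the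
  end of the loop of plane rotations `R_θ`, `θ ∈ [0, π]`, of the `(zᵢ, zⱼ)`-plane, which preserve
  `zᵢ² + zⱼ²` and hence `F` (Carlson–Toledo's "`(−1) ⊗ (−1)`" is trivial on the homology of the fibre).
* §3 the local model of the cyclic node, `a = (2, 2, p)`: the model monodromy
  `h = negPairFibre ∘ rotateFibre ζ` and the covering rotation `rotateFibre ζ` induce THE SAME map on
  `H₂(F)` (`map_modelMonodromy_eq_map_rotateFibre`), which has no non-zero invariant vector when `ζ` runs
  over `Ω_p` (`eq_zero_of_forall_map_rotateFibre_eq`).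

What is NOT here: the rank `p − 1` of `H₂(F)` and its intersection form (the `A_{p−1}` lattice); the
identification of the affine fibre with the Milnor fibre in a ball and the LOCALISATION of the monodromy of a
projective degeneration (the remaining, analytic part of programme I2); no definition of mathematical content
beyond the two homeomorphisms, no named fact.

## References

* [Milnor1968] J. Milnor, Singular Points of Complex Hypersurfaces, Ann. of Math. Studies 61 (1968), §9,
  Lemma 9.2, Thm. 9.1 and p. 77 (`h_* = r_{a₁*} ⊗ ⋯ ⊗ r_{a_m*}`; weighted-homogeneous monodromy Lemma 9.4).
* [CarlsonToledo1999] J. A. Carlson, D. Toledo, Discriminant complements and kernels of monodromy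
  representations, Duke Math. J. 97 (1999), §6 ((kdoublept), "`T = σ_0⊗(−1)⊗⋯⊗(−1)`"; held text p0013–p0014).
* [Pham1965] F. Pham, Formules de Picard–Lefschetz généralisées et ramification des intégrales, Bull. Soc.
  Math. France 93 (1965) 333–367, §1.
-/

noncomputable section

open Complex ContinuousMap Set Filter CategoryTheory
open Literature.AlgebraicTopology.SingularHomology
open scoped unitInterval Topology

namespace Literature.Geometry.ComplexAnalytic

namespace PhamBrieskorn

/-! ### §1 Rotations of the last coordinate on the fibre; no invariants on `Hₙ(F)` -/

section Rotate

variable {n : ℕ} (a : Fin (n + 1) → ℕ)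

/-- Rotation of the last coordinate by `v ∈ Ω_{aₙ}` preserves the fibre `F = {Σ zᵢ^{aᵢ} = 1}`.
[cite: Milnor1968, §9 p. 77] -/
theorem rotateFun_mem_fibre {v : ℂ} (hv : v ∈ Omega (a (Fin.last n))) {z : Fin (n + 1) → ℂ}
    (hz : z ∈ fibre a) : rotateFun v z ∈ fibre a :=
  smul_mem_fibre (snoc_one_pow hv) hz

/-- **Rotation of the last coordinate by `v ∈ Ω_{aₙ}` as a self-homeomorphism of the fibre `F`** (Milnor's
`r_{aₙ}` extended from `J` to the Milnor fibre; it is the covering automorphism `σ` of Carlson–Toledo §6 when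
`aₙ = k`). [cite: Milnor1968, §9 p. 77] -/
def rotateFibre (ha : ∀ i, a i ≠ 0) (v : Omega (a (Fin.last n))) : fibre a ≃ₜ fibre a where
  toFun z := ⟨rotateFun v z, rotateFun_mem_fibre a v.2 z.2⟩
  invFun z := ⟨rotateFun (v : ℂ)⁻¹ z, rotateFun_mem_fibre a (inv_mem_Omega v.2) z.2⟩
  left_inv z := Subtype.ext (by
    change rotateFun (v : ℂ)⁻¹ (rotateFun v (z : Fin (n + 1) → ℂ)) = (z : Fin (n + 1) → ℂ)
    rw [rotateFun_rotateFun, inv_mul_cancel₀ (ne_zero_of_mem_Omega (ha _) v.2), rotateFun_one])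
  right_inv z := Subtype.ext (by
    change rotateFun v (rotateFun (v : ℂ)⁻¹ (z : Fin (n + 1) → ℂ)) = (z : Fin (n + 1) → ℂ)
    rw [rotateFun_rotateFun, mul_inv_cancel₀ (ne_zero_of_mem_Omega (ha _) v.2), rotateFun_one])
  continuous_toFun := ((continuous_rotateFun v).comp continuous_subtype_val).subtype_mk _
  continuous_invFun := ((continuous_rotateFun _).comp continuous_subtype_val).subtype_mk _

/-- `rotateFibre` on points. [cite: Milnor1968, §9 p. 77] -/
@[simp] theorem rotateFibre_apply_coe (ha : ∀ i, a i ≠ 0) (v : Omega (a (Fin.last n))) (z : fibre a) :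
    (rotateFibre a ha v z : Fin (n + 1) → ℂ) = rotateFun v z := rfl

/-- The inclusion `J ↪ F` intertwines the rotations of the join and of the fibre. [cite: Milnor1968, §9 p. 77] -/
theorem inclusion_comp_rotate (ha : ∀ i, a i ≠ 0) (v : Omega (a (Fin.last n))) :
    (⟨Set.inclusion join_subset_fibre, continuous_inclusion join_subset_fibre⟩ : C(join a, fibre a)).comp
        (rotate a ha v : C(join a, join a)) =
      (rotateFibre a ha v : C(fibre a, fibre a)).comp
        ⟨Set.inclusion join_subset_fibre, continuous_inclusion join_subset_fibre⟩ := by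
  ext z : 1
  exact Subtype.ext rfl

end Rotate

section NoInvariants

variable (F : Type) [Field F] [CharZero F] {n : ℕ} {a : Fin (n + 2) → ℕ} (ha : ∀ i, a i ≠ 0)

/-- **The rotations of the last coordinate have no non-zero invariant vector on `Hₙ₊₁(F)`** (`n + 2 ≥ 2`
factors, coefficients in a field of characteristic zero): a class of the fibre fixed by all `(rotateFibre v)_*`,
`v ∈ Ω_{aₙ₊₁}`, vanishes. The join statement `eq_zero_of_forall_map_rotate_eq` transported along the
inclusion `J ↪ F`, a homotopy equivalence (`joinHomotopyEquivFibre`) commuting with the rotations.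
[cite: Milnor1968, §9 Thm. 9.1 and p. 77] -/
theorem eq_zero_of_forall_map_rotateFibre_eq (x : singularHomology F F (fibre a) (n + 1))
    (hx : ∀ v : Omega (a (Fin.last (n + 1))),
      singularHomology.map F F (rotateFibre a ha v : C(fibre a, fibre a)) (n + 1) x = x) :
    x = 0 := by
  -- the inclusion `J ↪ F` is an isomorphism on homology
  let e := joinHomotopyEquivFibre a ha
  let ι : C(join a, fibre a) := ⟨Set.inclusion join_subset_fibre, continuous_inclusion join_subset_fibre⟩
  have hι : e.toFun = ι := joinHomotopyEquivFibre_toFun a ha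
  let Φ := singularHomology.isoOfHomotopyEquiv F F e (n + 1)
  have hΦ : Φ.hom = singularHomology.map F F ι (n + 1) := by
    change singularHomology.map F F e.toFun (n + 1) = _
    rw [hι]
  -- pull `x` back to the join
  obtain ⟨y, rfl⟩ : ∃ y, Φ.hom y = x := ⟨Φ.inv x, by rw [← ModuleCat.comp_apply, Φ.inv_hom_id]; rfl⟩
  have hy : ∀ v : Omega (a (Fin.last (n + 1))),
      singularHomology.map F F (rotate a ha v : C(join a, join a)) (n + 1) y = y := by
    intro v
    have h1 := hx v
    rw [hΦ, ← ModuleCat.comp_apply, ← singularHomology.map_comp, ← inclusion_comp_rotate a ha v,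
      singularHomology.map_comp, ModuleCat.comp_apply] at h1
    have hinj : Function.Injective (Φ.hom) :=
      ((forget (ModuleCat F)).mapIso Φ).toEquiv.injective
    rw [hΦ] at hinj
    exact hinj h1
  rw [eq_zero_of_forall_map_rotate_eq F ha y hy, map_zero]

end NoInvariants

/-! ### §2 The sign change of two quadratic coordinates is homotopic to the identity -/

section NegPair

variable {ι : Type} [DecidableEq ι] {i j : ι}

/-- The plane rotation `R_θ` of the coordinates `i, j` by the angle `π θ`:
`(zᵢ, zⱼ) ↦ (cos(πθ) zᵢ − sin(πθ) zⱼ, sin(πθ) zᵢ + cos(πθ) zⱼ)`, the other coordinates fixed.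
[cite: CarlsonToledo1999, §6 (held text p0013)] -/
def planeRotFun (i j : ι) (θ : ℝ) (z : ι → ℂ) : ι → ℂ :=
  fun k => if k = i then (Real.cos (Real.pi * θ) : ℂ) * z i - (Real.sin (Real.pi * θ) : ℂ) * z j
    else if k = j then (Real.sin (Real.pi * θ) : ℂ) * z i + (Real.cos (Real.pi * θ) : ℂ) * z j else z k

/-- `R_θ` is jointly continuous in `(θ, z)`. [cite: CarlsonToledo1999, §6 (held text p0013)] -/
theorem continuous_planeRotFun (i j : ι) :
    Continuous fun q : ℝ × (ι → ℂ) => planeRotFun i j q.1 q.2 := by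
  refine continuous_pi fun k => ?_
  have hc : Continuous fun q : ℝ × (ι → ℂ) => (Real.cos (Real.pi * q.1) : ℂ) :=
    Complex.continuous_ofReal.comp ((Real.continuous_cos.comp (continuous_const.mul continuous_fst)))
  have hs : Continuous fun q : ℝ × (ι → ℂ) => (Real.sin (Real.pi * q.1) : ℂ) :=
    Complex.continuous_ofReal.comp ((Real.continuous_sin.comp (continuous_const.mul continuous_fst)))
  have hzi : Continuous fun q : ℝ × (ι → ℂ) => q.2 i := (continuous_apply i).comp continuous_snd
  have hzj : Continuous fun q : ℝ × (ι → ℂ) => q.2 j := (continuous_apply j).comp continuous_snd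
  have hzk : Continuous fun q : ℝ × (ι → ℂ) => q.2 k := (continuous_apply k).comp continuous_snd
  by_cases hki : k = i
  · subst hki
    simp only [planeRotFun, if_true]
    exact (hc.mul hzi).sub (hs.mul hzj)
  · by_cases hkj : k = j
    · subst hkj
      simp only [planeRotFun, if_neg hki, if_true]
      exact (hs.mul hzi).add (hc.mul hzj)
    · simp only [planeRotFun, if_neg hki, if_neg hkj]
      exact hzk

/-- `R_0 = id`. [cite: CarlsonToledo1999, §6 (held text p0013)] -/
theorem planeRotFun_zero (i j : ι) (hij : i ≠ j) (z : ι → ℂ) : planeRotFun i j 0 z = z := by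
  funext k
  by_cases hki : k = i
  · subst hki; simp [planeRotFun]
  · by_cases hkj : k = j
    · subst hkj; simp [planeRotFun, hki]
    · simp [planeRotFun, hki, hkj]

/-- `R_1` is the sign change of the coordinates `i, j`. [cite: CarlsonToledo1999, §6 (held text p0013)] -/
theorem planeRotFun_one (i j : ι) (hij : i ≠ j) (z : ι → ℂ) :
    planeRotFun i j 1 z = fun k => if k = i ∨ k = j then -z k else z k := by
  funext k
  by_cases hki : k = i
  · subst hki; simp [planeRotFun]
  · by_cases hkj : k = j
    · subst hkj; simp [planeRotFun, hki]
    · simp [planeRotFun, hki, hkj]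

variable [Fintype ι] (a : ι → ℕ)

/-- `R_θ` preserves `zᵢ² + zⱼ²`, hence the fibre when `aᵢ = aⱼ = 2`. [cite: CarlsonToledo1999, §6 (held text p0013)] -/
theorem planeRotFun_mem_fibre (hij : i ≠ j) (hi : a i = 2) (hj : a j = 2) (θ : ℝ) {z : ι → ℂ}
    (hz : z ∈ fibre a) : planeRotFun i j θ z ∈ fibre a := by
  rw [mem_fibre] at hz ⊢
  -- split off the coordinates `i` and `j` from the sum
  have hsplit : ∀ w : ι → ℂ, ∑ k, w k ^ a k =
      w i ^ 2 + w j ^ 2 + ∑ k ∈ (Finset.univ.erase i).erase j, w k ^ a k := by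
    intro w
    rw [← Finset.add_sum_erase _ _ (Finset.mem_univ i), hi,
      ← Finset.add_sum_erase _ _ (Finset.mem_erase.2 ⟨hij.symm, Finset.mem_univ j⟩), hj, add_assoc]
  have hrest : ∑ k ∈ (Finset.univ.erase i).erase j, planeRotFun i j θ z k ^ a k =
      ∑ k ∈ (Finset.univ.erase i).erase j, z k ^ a k := by
    refine Finset.sum_congr rfl fun k hk => ?_
    have hkj : k ≠ j := (Finset.mem_erase.1 hk).1
    have hki : k ≠ i := (Finset.mem_erase.1 (Finset.mem_erase.1 hk).2).1
    simp [planeRotFun, hkj, hki]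
  have hc : (Real.cos (Real.pi * θ) : ℂ) ^ 2 + (Real.sin (Real.pi * θ) : ℂ) ^ 2 = 1 := by
    rw [← Complex.ofReal_pow, ← Complex.ofReal_pow, ← Complex.ofReal_add, Real.cos_sq_add_sin_sq,
      Complex.ofReal_one]
  rw [hsplit, hrest]
  rw [hsplit] at hz
  have hij' : j ≠ i := hij.symm
  have h2 : planeRotFun i j θ z i ^ 2 + planeRotFun i j θ z j ^ 2 = z i ^ 2 + z j ^ 2 := by
    simp only [planeRotFun, if_true, if_neg hij']
    linear_combination (z i ^ 2 + z j ^ 2) * hc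
  rw [h2]
  exact hz

/-- The sign change `(zᵢ, zⱼ) ↦ (−zᵢ, −zⱼ)` preserves the fibre when `aᵢ = aⱼ = 2`.
[cite: CarlsonToledo1999, §6 (held text p0013)] -/
theorem negPair_mem_fibre (hij : i ≠ j) (hi : a i = 2) (hj : a j = 2) {z : ι → ℂ} (hz : z ∈ fibre a) :
    (fun k => if k = i ∨ k = j then -z k else z k) ∈ fibre a := by
  rw [← planeRotFun_one i j hij z]
  exact planeRotFun_mem_fibre a hij hi hj 1 hz

/-- **The sign change of two quadratic coordinates as a self-homeomorphism of the fibre** (an involution;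
Carlson–Toledo's factor "`(−1) ⊗ (−1)`" of the local monodromy `T = σ_0 ⊗ (−1) ⊗ (−1)` at (kdoublept)).
[cite: CarlsonToledo1999, §6 (held text p0013)] -/
def negPairFibre (hij : i ≠ j) (hi : a i = 2) (hj : a j = 2) : fibre a ≃ₜ fibre a where
  toFun z := ⟨fun k => if k = i ∨ k = j then -(z : ι → ℂ) k else (z : ι → ℂ) k, negPair_mem_fibre a hij hi hj z.2⟩
  invFun z := ⟨fun k => if k = i ∨ k = j then -(z : ι → ℂ) k else (z : ι → ℂ) k, negPair_mem_fibre a hij hi hj z.2⟩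
  left_inv z := Subtype.ext (funext fun k => by by_cases h : k = i ∨ k = j <;> simp [h])
  right_inv z := Subtype.ext (funext fun k => by by_cases h : k = i ∨ k = j <;> simp [h])
  continuous_toFun := by
    refine Continuous.subtype_mk (continuous_pi fun k => ?_) _
    by_cases h : k = i ∨ k = j
    · simp only [h, if_true]; exact ((continuous_apply k).comp continuous_subtype_val).neg
    · simp only [h, if_false]; exact (continuous_apply k).comp continuous_subtype_val
  continuous_invFun := by
    refine Continuous.subtype_mk (continuous_pi fun k => ?_) _
    by_cases h : k = i ∨ k = j
    · simp only [h, if_true]; exact ((continuous_apply k).comp continuous_subtype_val).neg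
    · simp only [h, if_false]; exact (continuous_apply k).comp continuous_subtype_val

/-- `negPairFibre` on points. [cite: CarlsonToledo1999, §6 (held text p0013)] -/
@[simp] theorem negPairFibre_apply_coe (hij : i ≠ j) (hi : a i = 2) (hj : a j = 2) (z : fibre a) :
    (negPairFibre a hij hi hj z : ι → ℂ) = fun k => if k = i ∨ k = j then -(z : ι → ℂ) k else (z : ι → ℂ) k :=
  rfl

/-- The homotopy `(θ, z) ↦ R_θ z` from the identity to the sign change of the coordinates `i, j`, as a
continuous map `[0,1] × F → F`. [cite: CarlsonToledo1999, §6 (held text p0013)] -/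
def planeRotMap (hij : i ≠ j) (hi : a i = 2) (hj : a j = 2) : C(I × fibre a, fibre a) where
  toFun q := ⟨planeRotFun i j (q.1 : ℝ) (q.2 : ι → ℂ), planeRotFun_mem_fibre a hij hi hj _ q.2.2⟩
  continuous_toFun :=
    ((continuous_planeRotFun i j).comp
      ((continuous_subtype_val.comp continuous_fst).prodMk
        (continuous_subtype_val.comp continuous_snd))).subtype_mk _

/-- `planeRotMap` on points. [cite: CarlsonToledo1999, §6 (held text p0013)] -/
theorem planeRotMap_apply_coe (hij : i ≠ j) (hi : a i = 2) (hj : a j = 2) (q : I × fibre a) :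
    (planeRotMap a hij hi hj q : ι → ℂ) = planeRotFun i j (q.1 : ℝ) (q.2 : ι → ℂ) := rfl

/-- **The sign change of two quadratic coordinates is homotopic to the identity of the fibre**, through the
plane rotations `R_θ`, `θ ∈ [0, 1]` (angle `πθ`). [cite: CarlsonToledo1999, §6 (held text p0013)] -/
def negPairHomotopy (hij : i ≠ j) (hi : a i = 2) (hj : a j = 2) :
    ContinuousMap.Homotopy (ContinuousMap.id (fibre a)) (negPairFibre a hij hi hj : C(fibre a, fibre a)) where
  toContinuousMap := planeRotMap a hij hi hj
  map_zero_left z := by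
    apply Subtype.ext
    rw [ContinuousMap.id_apply]
    change planeRotFun i j ((0 : I) : ℝ) (z : ι → ℂ) = (z : ι → ℂ)
    rw [Set.Icc.coe_zero, planeRotFun_zero i j hij]
  map_one_left z := by
    apply Subtype.ext
    change planeRotFun i j ((1 : I) : ℝ) (z : ι → ℂ) = (negPairFibre a hij hi hj z : ι → ℂ)
    rw [Set.Icc.coe_one, planeRotFun_one i j hij, negPairFibre_apply_coe]

/-- The identity of the fibre is homotopic to the sign change of two quadratic coordinates.
[cite: CarlsonToledo1999, §6 (held text p0013)] -/
theorem negPairFibre_homotopic_id (hij : i ≠ j) (hi : a i = 2) (hj : a j = 2) :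
    ContinuousMap.Homotopic (ContinuousMap.id (fibre a)) (negPairFibre a hij hi hj : C(fibre a, fibre a)) :=
  ⟨negPairHomotopy a hij hi hj⟩

/-- **The sign change of two quadratic coordinates acts as the identity on the homology of the fibre** (any
coefficients, every degree). [cite: CarlsonToledo1999, §6 (held text p0013)] [cite: Milnor1968, §9 p. 77] -/
theorem map_negPairFibre_eq_id (R : Type) [CommRing R] (hij : i ≠ j) (hi : a i = 2) (hj : a j = 2) (b : ℕ) :
    singularHomology.map R R (negPairFibre a hij hi hj : C(fibre a, fibre a)) b = 𝟙 _ := by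
  rw [← singularHomology.map_eq_of_homotopic R R (negPairFibre_homotopic_id a hij hi hj) b]
  exact singularHomology.map_id R R b

end NegPair

/-! ### §3 The local model of the cyclic node: `z₀² + z₁² + z₂^p = 1` -/

section CyclicNode

variable (p : ℕ)

/-- The exponents `(2, 2, p)` of the local model `x₁² + x₂² + y^p` of the singularity (kdoublept) of a
`p`-fold cyclic cover of the plane branched along a one-nodal curve. [cite: CarlsonToledo1999, §6 (kdoublept) (held text p0013)] -/
def cyclicNodeExponents : Fin (1 + 2) → ℕ := ![2, 2, p]

/-- The exponents are non-zero for `p ≠ 0`. [cite: CarlsonToledo1999, §6 (kdoublept) (held text p0013)] -/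
theorem cyclicNodeExponents_ne_zero (hp : p ≠ 0) (i : Fin (1 + 2)) : cyclicNodeExponents p i ≠ 0 := by
  fin_cases i
  · exact two_ne_zero
  · exact two_ne_zero
  · exact hp

/-- The last exponent is `p`. [cite: CarlsonToledo1999, §6 (kdoublept) (held text p0013)] -/
@[simp] theorem cyclicNodeExponents_last : cyclicNodeExponents p (Fin.last 2) = p := rfl

/-- **In the local model of the cyclic node, the model monodromy `(z₀, z₁, z₂) ↦ (−z₀, −z₁, ζ z₂)` and the
covering rotation `(z₀, z₁, z₂) ↦ (z₀, z₁, ζ z₂)` induce the same map on the homology of the Milnor fibre**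
(Carlson–Toledo §6: `T = σ_0 ⊗ (−1) ⊗ (−1)` acts as the cyclic automorphism on the vanishing homology),
any coefficient ring, every degree. [cite: CarlsonToledo1999, §6 (kdoublept) and Proposition (held text p0013–p0014)] -/
theorem map_modelMonodromy_eq_map_rotateFibre (R : Type) [CommRing R] (hp : p ≠ 0)
    (v : Omega (cyclicNodeExponents p (Fin.last 2))) (b : ℕ) :
    singularHomology.map R R
        ((negPairFibre (cyclicNodeExponents p) (i := 0) (j := 1) (by decide) rfl rfl :
            C(fibre (cyclicNodeExponents p), fibre (cyclicNodeExponents p))).comp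
          (rotateFibre (cyclicNodeExponents p) (cyclicNodeExponents_ne_zero p hp) v :
            C(fibre (cyclicNodeExponents p), fibre (cyclicNodeExponents p)))) b =
      singularHomology.map R R
        (rotateFibre (cyclicNodeExponents p) (cyclicNodeExponents_ne_zero p hp) v :
          C(fibre (cyclicNodeExponents p), fibre (cyclicNodeExponents p))) b := by
  rw [singularHomology.map_comp, map_negPairFibre_eq_id, Category.comp_id]

/-- **In the local model of the cyclic node the covering rotations have no non-zero invariant vector on
`H₂` of the Milnor fibre** ("the eigenvalues are the `k`-th roots of unity `μ ≠ 1`"), coefficients in any field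
of characteristic zero. [cite: CarlsonToledo1999, §6 (held text p0013)] [cite: Milnor1968, §9 Thm. 9.1] -/
theorem eq_zero_of_forall_map_rotateFibre_cyclicNode_eq (F : Type) [Field F] [CharZero F] (hp : p ≠ 0)
    (x : singularHomology F F (fibre (cyclicNodeExponents p)) 2)
    (hx : ∀ v : Omega (cyclicNodeExponents p (Fin.last 2)),
      singularHomology.map F F (rotateFibre (cyclicNodeExponents p) (cyclicNodeExponents_ne_zero p hp) v :
        C(fibre (cyclicNodeExponents p), fibre (cyclicNodeExponents p))) 2 x = x) :
    x = 0 :=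
  eq_zero_of_forall_map_rotateFibre_eq F (cyclicNodeExponents_ne_zero p hp) x hx

/-- Consequently a class of `H₂` of the model Milnor fibre fixed by the model monodromies
`(−z₀, −z₁, ζ z₂)` for all `ζ ∈ Ω_p` vanishes (no invariant vanishing cycle). [cite: CarlsonToledo1999, §6 (held text p0013–p0014)] -/
theorem eq_zero_of_forall_map_modelMonodromy_eq (F : Type) [Field F] [CharZero F] (hp : p ≠ 0)
    (x : singularHomology F F (fibre (cyclicNodeExponents p)) 2)
    (hx : ∀ v : Omega (cyclicNodeExponents p (Fin.last 2)),
      singularHomology.map F F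
        ((negPairFibre (cyclicNodeExponents p) (i := 0) (j := 1) (by decide) rfl rfl :
            C(fibre (cyclicNodeExponents p), fibre (cyclicNodeExponents p))).comp
          (rotateFibre (cyclicNodeExponents p) (cyclicNodeExponents_ne_zero p hp) v :
            C(fibre (cyclicNodeExponents p), fibre (cyclicNodeExponents p)))) 2 x = x) :
    x = 0 := by
  refine eq_zero_of_forall_map_rotateFibre_cyclicNode_eq p F hp x fun v => ?_
  rw [← map_modelMonodromy_eq_map_rotateFibre p F hp v 2]
  exact hx v

end CyclicNode

end PhamBrieskorn

end Literature.Geometry.ComplexAnalytic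

end
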